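import Summits.KontsevichZagierPeriods.KontsevichZagierPeriods.Theses.TorsionLogs
import Summits.KontsevichZagierPeriods.KontsevichZagierPeriods.Theses.HermiteRigidity
import Summits.KontsevichZagierPeriods.KontsevichZagierPeriods.Theorems.TorsionLogsTorsionSectorCompleteReductions
import Summits.KontsevichZagierPeriods.KontsevichZagierPeriods.Theorems.FurushoPentagonSectorToKernelOfLeaves

/-!
# Crux `TorsionSectorComplete` (stmt-KontsevichZagierPeriods-14212) — line `ayoub-cube`
# (crux-strategist r1: the BC2-redirect decomposition as a registered skeleton)

Route `KontsevichZagierPeriods/TorsionLogs`.  With `NeronTorsionSector` (stmt-14500) proved, the crux is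
the summit (`TorsionSectorComplete.iff_summit_of_sector`), and the registered line `birth`
(`stub_surfaceDescent` + `stub_surfaceKernel`, lead c4–c13) is `blocked-on: KZKernelConjecture` with both
stubs conjecture-grade and no mechanism for the upper half (LEAD-c13.md, EQUIVALENCE-AUDIT.md).

This line replaces the dimension cut by the hub's canonical GEOMETRY / TRANSCENDENCE cut — the two
hub items, verbatim, as the stubs:

* `stub_cubeResolution`  = item stmt-17978 `HermiteRigidity.CubeResolution` (geometry INSIDE the rules:
  every class is congruent mod `KZ.relations` to a `ℤ`-combination of tame cube classes).  A THEOREM IN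
  SUBSTANCE: `cubeResolution_of_cubeNashNormalForm cubeNashNormalForm_proof` (landed) proves it up to
  unfolding — closing certificate `CubeResolutionNow.lean` (rc 0, axioms standard) attached on both items;
  this stub closes in one step.
* `stub_ayoubEffectiveCubeKernel` = item stmt-18116 `HermiteRigidity.AyoubEffectiveCubeKernel`
  (J. Ayoub, Ann. of Math. 181 (2015) Conj. 1.1 = Fresán 2024 Conj. 3.5 at `k = ℚ`: the kernel of
  `∫_{[0,1]^∞}` on `𝒪_{ℚ-alg}(𝔻̄^∞)` is the `ℚ`-span of the type-(a) Stokes elements).  OPEN, printed,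
  LINEAR presentation; registered skeleton `localise-at-two-pi-i` (𝒪-side localized kernel +
  2πi-cancellation); relative version a THEOREM (`ayoub_integration_injective_localized`).

Composition `TorsionSectorComplete_of : TorsionSectorComplete` (no hypotheses; `suffices` the implication, proved inline = the landed
split glue p171043 `TorsionLogs.TorsionSectorCompleteSplit.TorsionSectorComplete_of_subs`: the ≈ 3 000-line bridge
`kontsevichZagierPeriods_of_cubeResolution_of_ayoubKernel` (OfLeaves) followed by `TorsionSectorComplete.of_summit`), applied to the
two named stubs. Sorries: exactly the two stubs.
-/

namespace Summit.KontsevichZagierPeriods.KontsevichZagierPeriods.Cruxes.TorsionSectorComplete.AyoubCube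

open Literature.NumberTheory.Transcendental

/-- **Stub 1 (item stmt-17978 verbatim; a theorem in substance — see `CubeResolutionNow.lean`).**
Cube resolution inside the rules. [cite: Ayoub2014, Def. 9–10] [cite: KontsevichZagier2001, §1.2] -/
theorem stub_cubeResolution :
    ∀ (N : ℕ) (u : Literature.NumberTheory.Transcendental.KZ.IntegralRep N), ∃ c ∈ AddSubgroup.closure {d : Literature.NumberTheory.Transcendental.KZ.FormalRep | ∃ (n : ℕ) (r : Literature.NumberTheory.Transcendental.KZ.IntegralRep n), r.domain = {x : Fin n → ℝ | ∀ i, 0 ≤ x i ∧ x i ≤ 1} ∧ AnalyticOnNhd ℝ r.integrand {x : Fin n → ℝ | ∀ i, 0 ≤ x i ∧ x i ≤ 1} ∧ d = Literature.NumberTheory.Transcendental.KZ.of r}, Literature.NumberTheory.Transcendental.KZ.of u - c ∈ Literature.NumberTheory.Transcendental.KZ.relations := by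
  sorry

/-- **Stub 2 (item stmt-18116 verbatim; OPEN — Ayoub 2015 Conj. 1.1 at `k = ℚ`).** Type-(a) generation of
the kernel of `∫_{[0,1]^∞}` on `𝒪_{ℚ-alg}(𝔻̄^∞)`. [cite: Ayoub2015, Conj. 1.1] [cite: Fresan2024, Conj. 3.5] -/
theorem stub_ayoubEffectiveCubeKernel :
    ∀ F ∈ Literature.NumberTheory.Transcendental.AyoubRel.Oan (Rat.castHom ℂ), Literature.NumberTheory.Transcendental.AyoubRel.intC F = 0 → F ∈ Literature.NumberTheory.Transcendental.AyoubRel.kSpan (Rat.castHom ℂ) {x : Literature.NumberTheory.Transcendental.AyoubRel.CSeries | ∃ G ∈ Literature.NumberTheory.Transcendental.AyoubRel.Oan (Rat.castHom ℂ), ∃ i : ℕ, x = Literature.NumberTheory.Transcendental.AyoubRel.relAC i G} := by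
  sorry

/-- **Composition: the crux BY NAME from the two named stubs.** The `suffices` is the implication
`<stub_cubeResolution> → <stub_ayoubEffectiveCubeKernel> → TorsionSectorComplete` (a closed term with no `sorry` of its own:
the landed bridge `kontsevichZagierPeriods_of_cubeResolution_of_ayoubKernel` — item stmt-17978 IS the cubical resolution S1 up to
unfolding `cubicalSpan` / `cubicalGens` / `unitCube` — followed by `TorsionSectorComplete.of_summit`; it is also LANDED by name as
`TorsionLogs.TorsionSectorCompleteSplit.TorsionSectorComplete_of_subs`, p171043), applied to the two stubs. Axioms: the Mathlib
whitelist plus `sorryAx` through the two stubs only. [cite: KontsevichZagier2001, §1.2  Conjecture 1] [cite: Ayoub2015, Conj. 1.1] [folklore] -/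
theorem TorsionSectorComplete_of :
    Summit.KontsevichZagierPeriods.KontsevichZagierPeriods.Theses.TorsionLogs.TorsionSectorComplete := by
  suffices key :
      (∀ (N : ℕ) (u : Literature.NumberTheory.Transcendental.KZ.IntegralRep N), ∃ c ∈ AddSubgroup.closure {d : Literature.NumberTheory.Transcendental.KZ.FormalRep | ∃ (n : ℕ) (r : Literature.NumberTheory.Transcendental.KZ.IntegralRep n), r.domain = {x : Fin n → ℝ | ∀ i, 0 ≤ x i ∧ x i ≤ 1} ∧ AnalyticOnNhd ℝ r.integrand {x : Fin n → ℝ | ∀ i, 0 ≤ x i ∧ x i ≤ 1} ∧ d = Literature.NumberTheory.Transcendental.KZ.of r}, Literature.NumberTheory.Transcendental.KZ.of u - c ∈ Literature.NumberTheory.Transcendental.KZ.relations) →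
      (∀ F ∈ Literature.NumberTheory.Transcendental.AyoubRel.Oan (Rat.castHom ℂ), Literature.NumberTheory.Transcendental.AyoubRel.intC F = 0 → F ∈ Literature.NumberTheory.Transcendental.AyoubRel.kSpan (Rat.castHom ℂ) {x : Literature.NumberTheory.Transcendental.AyoubRel.CSeries | ∃ G ∈ Literature.NumberTheory.Transcendental.AyoubRel.Oan (Rat.castHom ℂ), ∃ i : ℕ, x = Literature.NumberTheory.Transcendental.AyoubRel.relAC i G}) →
      Summit.KontsevichZagierPeriods.KontsevichZagierPeriods.Theses.TorsionLogs.TorsionSectorComplete from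
    key stub_cubeResolution stub_ayoubEffectiveCubeKernel
  intro h₁ h₂
  exact Summit.KontsevichZagierPeriods.TorsionLogs.TorsionSectorComplete.of_summit
    (Summit.KontsevichZagierPeriods.FurushoPentagon.SectorToKernel.kontsevichZagierPeriods_of_cubeResolution_of_ayoubKernel
      (fun N u => by
        obtain ⟨c, hc, huc⟩ := h₁ N u
        exact ⟨c, hc, huc⟩)
      h₂)

/-- By-name reading: the stubs are the hub's route decls `HermiteRigidity.CubeResolution` /
`HermiteRigidity.AyoubEffectiveCubeKernel` (definitional unfolding). [folklore] -/
theorem stubs_are_items :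
    ((∀ (N : ℕ) (u : Literature.NumberTheory.Transcendental.KZ.IntegralRep N), ∃ c ∈ AddSubgroup.closure {d : Literature.NumberTheory.Transcendental.KZ.FormalRep | ∃ (n : ℕ) (r : Literature.NumberTheory.Transcendental.KZ.IntegralRep n), r.domain = {x : Fin n → ℝ | ∀ i, 0 ≤ x i ∧ x i ≤ 1} ∧ AnalyticOnNhd ℝ r.integrand {x : Fin n → ℝ | ∀ i, 0 ≤ x i ∧ x i ≤ 1} ∧ d = Literature.NumberTheory.Transcendental.KZ.of r}, Literature.NumberTheory.Transcendental.KZ.of u - c ∈ Literature.NumberTheory.Transcendental.KZ.relations) ↔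
      Summit.KontsevichZagierPeriods.KontsevichZagierPeriods.Theses.HermiteRigidity.CubeResolution) ∧
    ((∀ F ∈ Literature.NumberTheory.Transcendental.AyoubRel.Oan (Rat.castHom ℂ), Literature.NumberTheory.Transcendental.AyoubRel.intC F = 0 → F ∈ Literature.NumberTheory.Transcendental.AyoubRel.kSpan (Rat.castHom ℂ) {x : Literature.NumberTheory.Transcendental.AyoubRel.CSeries | ∃ G ∈ Literature.NumberTheory.Transcendental.AyoubRel.Oan (Rat.castHom ℂ), ∃ i : ℕ, x = Literature.NumberTheory.Transcendental.AyoubRel.relAC i G}) ↔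
      Summit.KontsevichZagierPeriods.KontsevichZagierPeriods.Theses.HermiteRigidity.AyoubEffectiveCubeKernel) :=
  ⟨Iff.rfl, Iff.rfl⟩

#print axioms TorsionSectorComplete_of

end Summit.KontsevichZagierPeriods.KontsevichZagierPeriods.Cruxes.TorsionSectorComplete.AyoubCube
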